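import Summits.QuantumFields.BalabanUV.T4Continuum.Support.NE7PairwiseCauchy
import Literature.MathematicalPhysics.QuantumFieldTheory.Balaban1983to89.T4GoodClassBudget

/-!
# NE7PairwiseOffsetEnd — row NE7 (node U5), route «PAIR-CAUCHY» (R-P2, 1-bis): the (E♭) INTERIM SOCKET — the
# pairwise END is road P1's `GoodClause` APPLIED PER OFFSET; a common null remainder and null bad-class weights give
# the (K2) hybrid family of `NE7PairwiseCauchy` and hence node U6's `GenFunCauchy`, BY NAME

Cell `pub-balaban`, rung (B)+1 sub-cell t4, lineage `b2b-balaban-t4-ne7-p2` (CRUX PROVER NE7 #2 under the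
coordinator ruling «YM redirect», 2026-08-21; generation 52 (v1.1 §4: generation 59); route text `HOME/t4/b2b-balaban-t4-ne7-p2/g51/
ROUTE2-NE7-P2.md` v1.6 §2 (E♭) «THE PAIRWISE END … A cheaper interim: instantiate P1's END as it stands for each
OFFSET n = K′ − K (B := run K+n) — it yields pair good clauses with δ⁗ₙ; PAIR-CAUCHY then needs only
`sup_n δ⁗ₙ K → 0`» and §5 item 1).  HONEST FRAMING (page 1): FIXED FINITE T⁴, rung (B)+1 = existence AND
uniqueness of the `ε = L^{−K} → 0` limit of unit-scale averaged expectations, CONDITIONAL on BetaPertH and the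
nine spine estimates (0/9 proved); NOT infinite volume, NOT a mass gap, NOT the Clay problem.  NE7 is NOT PRINTED
in [Balaban1984PropagatorsI]–[Balaban1989LargeFieldII] and NOT proved here.  Everything below is [folklore]
bookkeeping over HYPOTHESIS SHAPES (abstract finite families of reals); no definition, no cite tag, nothing
printed asserted, no `sorry`.

WHY.  Road P1's END (`TermwiseLocal.goodClause_summable_UN_levels_of_thm1At(_residualW)`, 93 binders) concludes
`T4GoodClassBudget.GoodClause l₀ vol T A B Bad δ ∧ Summable δ` for TWO ABSTRACT FAMILIES `A B : ℕ → ℝ → ι → ℝ`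
indexed by the number of steps `K` — it never uses that `B K` is «run `K+1`»; road P1 only reads it so at its
consecutive exit `T4GoodClassBudget.cauchy_of_goodClause` (`hZB : Z (K+1) t = Σ_{τ ∈ T K} B K t τ`).  Route
PAIR-CAUCHY compares run `K` with run `K′ = K + n` for EVERY offset `n` (run `K′`'s terms fibre-summed onto run
`K`'s labels, `B K K′`), so its END is P1's END applied to the pair family `(A, B·n)`, `(B·n) K := B K (K+n)`,
once per offset: this file is the SOCKET that turns «a good clause for every offset, with ONE remainder `δ K → 0`
and ONE bad-class weight `W K → 0` serving all offsets» into the (K2) hypothesis of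
`NE7PairwiseCauchy.pairMatching_of_hybridSandwich` ∕ `genFunCauchy_of_pairHybrid`, and so into node U6.  What it
LOCATES (the honest residual of (E♭), not discharged here): the n-UNIFORMITY of P1's END binders when `B := run
K+n` — by kind: (i) n-FREE by construction: every run-A binder, the one-run shapes (`Thm1At`, `Reg7`, (W-size),
(W-win), `Multiplicity`, `RecentOnly`, the (0.31) windows `Step.Discrete031` — a statement about ONE run's coupling
table), the constants `Cst, L, M, Mc, ε₁, β₀, κ, κ₀, R₁, Cw, Λ, w₀`; (ii) n-INDEXED DATA with n-free MAJORANTS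
REQUIRED: the two-run rates `URateUpTo K EA EB …` (E-, boundary- and 𝐑-kind: `Cr, EB₀, CrR, θ'` uniform in the
finer partner = ROUTE2 §3 «uniformity of the two-run moduli in the transport iterate n = K′ − K + 1»), the
normalisation∕witness∕residual radii `zB, rγ, rw, sw` (run-`K+n` sequences: one majorant sequence for all n),
the 𝐑-sizes `hRSB` and coupling tables `gsB, gfB` of run `K+n` read at levels `≤ K` (printed-type one-run sizes,
n-free as SIZES); (iii) the bad class `Bad` and its weight: NE7b's `RelWeightBound` for the pair (its `Summable W`
field is NOT needed here — only `W K → 0`, `W K < 1`).  With (ii) supplied n-uniformly, P1's `δ` (a closed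
formula in the constants and those sequences) is n-free and summable, hence null, and this socket fires.

WHAT IS PROVED ([folklore]).
§1 `goodClause_offset_apply` (reading a per-offset good clause at the pair `(K, K+n)`);
   **`hybridSandwich_of_offsetGoodClauses`** — per-offset good clauses with a common `δ`, bad classes `Bad K K′ t ⊆
   T K` of relative weight `≤ W K` in run `K` and in run `K′` (fibre-summed), nonnegative terms ⟹ for every pair
   `K ≤ K′` the `HybridSandwich` of (K2) with good set `T K ∖ Bad K K′ t`, radius `vol·δ K`, weight `W K`.
§2 **`pairMatching_of_offsetGoodClauses`** (⟹ `|log Z K′ t − log Z K t − c| ≤ vol·hybridDelta vol δ W K` for all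
   `K ≤ K′`, by `NE7PairwiseCauchy.pairMatching_of_hybridSandwich`); **`genFunCauchy_of_offsetGoodClauses`** (node U6
   `T4Assembly.GenFunCauchy S l₀` from per-string offset good clauses with `δ → 0`, `W → 0`, `W < 1`, by
   `NE7PairwiseCauchy.genFunCauchy_of_pairHybrid`); `hasContinuumLimit_of_offsetGoodClauses` (node U0).
§3 `tendsto_zero_of_goodClause_summable` — the by-name remark that P1's END output `Summable δ` (with `0 ≤ δ`) is
   MORE than this socket asks (`δ → 0`).
§4 (v1.1, generation 59 — the exit-level half of the junction «ℓ¹ ⟹ null» with route ℓ¹, companion of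
   `NE7PairwiseL1Junction`) **`pairMatching_of_matchingModConstants`**: node U5 AS TYPED (`MatchingModConstants`,
   consecutive) with the currency `Summable δ` of road P1 ∕ route ℓ¹ ⟹ the PAIR-MATCHING hypothesis of (K1)
   `NE7PairwiseCauchy.cauchySeq_genFun_of_pairMatching` with the ℓ¹ TAIL `vol·Σ'_i δ (i + K)` as remainder
   (telescoping over the runs); `tendsto_l1TailRemainder`; **`cauchySeq_genFun_of_matchingModConstants_pairwise`** —
   node U6's `CauchySeq` recovered THROUGH the pairwise socket under `T4CauchySum.cauchySeq_genFun`'s own inputs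
   (1-bis literally at the exit; with `NE7PairwiseCauchy.not_cauchySeq_of_harmonic_steps`: ℓ¹ ⟹ null ⟹ Cauchy,
   null ⇏ Cauchy).

NOT DELIVERED: the n-uniform majorants of (ii) (they are the other rows' two-run asks in PAIR-CAUCHY's weakened
currency, ROUTE2 §2 T.1♭∕T.3♭∕T.4♭∕T.5♭, and road P1's own (S1)∕NODE O items — unchanged); the windowed variant
(`NE7PairwiseCauchyWindow.pairCauchy_of_windowedHybrid`, window depth a free parameter) is not re-socketed here;
any instance for Bałaban's runs.  NOT NE7 (spine 0/9 unchanged), NOT summit progress.  HONEST DEPENDENCY: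
continuum YM on T⁴ ⇐ BetaPertH ∧ nine spine estimates (0/9 proved); BetaPertH ⇐ (D1) ∧ (D4) ∧ CAP+tail; G-an2-4
gates asym, D1 and NE2/3/4.
-/

noncomputable section

open Finset Filter Topology
open scoped BigOperators

namespace Summit.QuantumFields.BalabanUV.T4Continuum.NE7PairwiseOffsetEnd

open Literature.MathematicalPhysics.QuantumFieldTheory
open Literature.MathematicalPhysics.QuantumFieldTheory.Balaban1983to89
open T4HybridMatching (HybridSandwich hybridDelta)
open T4GoodClassBudget (GoodClause)
open Summit.QuantumFields.BalabanUV.T4Continuum.NE7PairwiseCauchy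
  (pairMatching_of_hybridSandwich genFunCauchy_of_pairHybrid hasContinuumLimit_of_pairMatching
    tendsto_hybridDelta_zero)

/-! ## §1 Per-offset good clauses ⟹ the pairwise hybrid sandwiches of (K2) -/

section Socket

variable {ι : Type*} [DecidableEq ι] {l₀ vol : ℝ} {T : ℕ → Finset ι} {A : ℕ → ℝ → ι → ℝ}
  {B : ℕ → ℕ → ℝ → ι → ℝ} {Bad : ℕ → ℕ → ℝ → Finset ι} {δ W : ℕ → ℝ}

/-- READING A PER-OFFSET GOOD CLAUSE AT A PAIR: the good clause of the offset-`n` family `K ↦ B K (K+n)` with bad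
classes `K ↦ Bad K (K+n)`, read at `K`, is the sandwich for the pair `(K, K+n)`. [folklore] -/
theorem goodClause_offset_apply
    (hgood : ∀ n : ℕ, GoodClause l₀ vol T A (fun K => B K (K + n)) (fun K => Bad K (K + n)) δ) (K n : ℕ) :
    ∃ c : ℝ, ∀ t : ℝ, |t| ≤ l₀ → ∀ τ ∈ T K \ Bad K (K + n) t,
      Real.exp (c - vol * δ K) * A K t τ ≤ B K (K + n) t τ ∧
        B K (K + n) t τ ≤ Real.exp (c + vol * δ K) * A K t τ :=
  hgood n K

/-- **PER-OFFSET GOOD CLAUSES ⟹ THE (K2) HYBRID FAMILY.**  Good clauses for every offset family with ONE remainder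
`δ`, bad classes `Bad K K′ t ⊆ T K` of relative weight `≤ W K` in run `K` (`A K t`) and in run `K′` fibre-summed
(`B K K′ t`), nonnegative terms ⟹ for every pair `K ≤ K′` and `|t| ≤ l₀` the hybrid sandwich of
`NE7PairwiseCauchy.pairMatching_of_hybridSandwich` with good set `T K ∖ Bad K K′ t`. [folklore] -/
theorem hybridSandwich_of_offsetGoodClauses
    (hA : ∀ K t, |t| ≤ l₀ → ∀ τ ∈ T K, 0 ≤ A K t τ)
    (hB : ∀ K K' t, K ≤ K' → |t| ≤ l₀ → ∀ τ ∈ T K, 0 ≤ B K K' t τ)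
    (hbad : ∀ K K' t, K ≤ K' → |t| ≤ l₀ → Bad K K' t ⊆ T K)
    (hWA : ∀ K K' t, K ≤ K' → |t| ≤ l₀ → ∑ τ ∈ Bad K K' t, A K t τ ≤ W K * ∑ τ ∈ T K, A K t τ)
    (hWB : ∀ K K' t, K ≤ K' → |t| ≤ l₀ → ∑ τ ∈ Bad K K' t, B K K' t τ ≤ W K * ∑ τ ∈ T K, B K K' t τ)
    (hgood : ∀ n : ℕ, GoodClause l₀ vol T A (fun K => B K (K + n)) (fun K => Bad K (K + n)) δ) :
    ∀ K K' : ℕ, K ≤ K' → ∃ c : ℝ, ∀ t : ℝ, |t| ≤ l₀ →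
      HybridSandwich (T K) (T K \ Bad K K' t) (A K t) (B K K' t) c (vol * δ K) (W K) := by
  intro K K' hKK'
  obtain ⟨n, rfl⟩ := Nat.exists_eq_add_of_le hKK'
  obtain ⟨c, hc⟩ := goodClause_offset_apply hgood K n
  refine ⟨c, fun t ht => ?_⟩
  have hsd : T K \ (T K \ Bad K (K + n) t) = Bad K (K + n) t :=
    Finset.sdiff_sdiff_eq_self (hbad K (K + n) t hKK' ht)
  exact
    { subset := Finset.sdiff_subset
      nonneg_left := hA K t ht
      nonneg_right := hB K (K + n) t hKK' ht
      lower := fun τ hτ => (hc t ht τ hτ).1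
      upper := fun τ hτ => (hc t ht τ hτ).2
      bad_left := by rw [hsd]; exact hWA K (K + n) t hKK' ht
      bad_right := by rw [hsd]; exact hWB K (K + n) t hKK' ht }

/-! ## §2 … ⟹ pair matching with null remainder ⟹ node U6 ∕ U0 -/

/-- **PAIR MATCHING FROM PER-OFFSET GOOD CLAUSES**: with `Z K t = Σ_{T K} A K t`, `Z K′ t = Σ_{T K} B K K′ t` (run
`K′` fibre-summed onto run `K`'s labels), positivity and `W K < 1`: for all `K ≤ K′`,
`|log Z K′ t − log Z K t − c| ≤ vol·hybridDelta vol δ W K` on `|t| ≤ l₀`. [folklore] -/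
theorem pairMatching_of_offsetGoodClauses {Z : ℕ → ℝ → ℝ} (hvol : 0 < vol)
    (hZA : ∀ (K : ℕ) (t : ℝ), |t| ≤ l₀ → Z K t = ∑ τ ∈ T K, A K t τ)
    (hZB : ∀ (K K' : ℕ) (t : ℝ), K ≤ K' → |t| ≤ l₀ → Z K' t = ∑ τ ∈ T K, B K K' t τ)
    (hpos : ∀ (K : ℕ) (t : ℝ), |t| ≤ l₀ → 0 < ∑ τ ∈ T K, A K t τ) (hW1 : ∀ K, W K < 1)
    (hA : ∀ K t, |t| ≤ l₀ → ∀ τ ∈ T K, 0 ≤ A K t τ)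
    (hB : ∀ K K' t, K ≤ K' → |t| ≤ l₀ → ∀ τ ∈ T K, 0 ≤ B K K' t τ)
    (hbad : ∀ K K' t, K ≤ K' → |t| ≤ l₀ → Bad K K' t ⊆ T K)
    (hWA : ∀ K K' t, K ≤ K' → |t| ≤ l₀ → ∑ τ ∈ Bad K K' t, A K t τ ≤ W K * ∑ τ ∈ T K, A K t τ)
    (hWB : ∀ K K' t, K ≤ K' → |t| ≤ l₀ → ∑ τ ∈ Bad K K' t, B K K' t τ ≤ W K * ∑ τ ∈ T K, B K K' t τ)
    (hgood : ∀ n : ℕ, GoodClause l₀ vol T A (fun K => B K (K + n)) (fun K => Bad K (K + n)) δ) :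
    ∀ K K' : ℕ, K ≤ K' → ∃ c : ℝ, ∀ t : ℝ, |t| ≤ l₀ →
      |Real.log (Z K' t) - Real.log (Z K t) - c| ≤ vol * hybridDelta vol δ W K :=
  pairMatching_of_hybridSandwich hvol hZA hZB hpos hW1 (Gd := fun K K' t => T K \ Bad K K' t)
    (hybridSandwich_of_offsetGoodClauses hA hB hbad hWA hWB hgood)

end Socket

section Exit

open Missing T4Continuum T4Assembly

variable {G : Type*} [GaugeGroup G] [MeasurableSpace G] [HaarData G] {O : Type*}

/-- **NODE U6 FROM PER-OFFSET GOOD CLAUSES** (the (E♭) interim of ROUTE2 §2, BY NAME): per string `os`, labels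
`T`, run-`K` terms `A`, run-`K′` terms fibre-summed `B K K′`, pair bad classes `Bad K K′ t ⊆ T K` of relative
weight `≤ W K` in both runs, and FOR EVERY OFFSET `n` road P1's good clause for the family `(A, K ↦ B K (K+n))`
with ONE remainder `δ`; if `δ → 0`, `W → 0`, `W < 1`, then `GenFunCauchy S l₀`.  The producer of the per-offset
good clauses is road P1's END applied to `(A, B·n)` — once its two-run binders hold uniformly in `n` (header (ii)).
[folklore] -/
theorem genFunCauchy_of_offsetGoodClauses {ι : Type*} [DecidableEq ι] (S : TorusScheme G O) {l₀ : ℝ}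
    (hl₀ : 0 ≤ l₀)
    (h : ∀ os : List O, ∃ (vol : ℝ) (T : ℕ → Finset ι) (A : ℕ → ℝ → ι → ℝ) (B : ℕ → ℕ → ℝ → ι → ℝ)
      (Bad : ℕ → ℕ → ℝ → Finset ι) (δ W : ℕ → ℝ), 0 < vol ∧ Tendsto δ atTop (𝓝 0) ∧ Tendsto W atTop (𝓝 0) ∧
      (∀ K, W K < 1) ∧
      (∀ (K : ℕ) (t : ℝ), |t| ≤ l₀ → T4GenFunBounds.schemeZ S os K t = ∑ τ ∈ T K, A K t τ) ∧
      (∀ (K K' : ℕ) (t : ℝ), K ≤ K' → |t| ≤ l₀ → T4GenFunBounds.schemeZ S os K' t = ∑ τ ∈ T K, B K K' t τ) ∧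
      (∀ (K : ℕ) (t : ℝ), |t| ≤ l₀ → 0 < ∑ τ ∈ T K, A K t τ) ∧
      (∀ K t, |t| ≤ l₀ → ∀ τ ∈ T K, 0 ≤ A K t τ) ∧
      (∀ K K' t, K ≤ K' → |t| ≤ l₀ → ∀ τ ∈ T K, 0 ≤ B K K' t τ) ∧
      (∀ K K' t, K ≤ K' → |t| ≤ l₀ → Bad K K' t ⊆ T K) ∧
      (∀ K K' t, K ≤ K' → |t| ≤ l₀ → ∑ τ ∈ Bad K K' t, A K t τ ≤ W K * ∑ τ ∈ T K, A K t τ) ∧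
      (∀ K K' t, K ≤ K' → |t| ≤ l₀ → ∑ τ ∈ Bad K K' t, B K K' t τ ≤ W K * ∑ τ ∈ T K, B K K' t τ) ∧
      (∀ n : ℕ, GoodClause l₀ vol T A (fun K => B K (K + n)) (fun K => Bad K (K + n)) δ)) :
    GenFunCauchy S l₀ := by
  refine genFunCauchy_of_pairHybrid (ι := ι) S hl₀ fun os => ?_
  obtain ⟨vol, T, A, B, Bad, δ, W, hvol, hδ, hW, hW1, hZA, hZB, hpos, hA, hB, hbad, hWA, hWB, hgood⟩ := h os
  exact ⟨vol, T, A, B, fun K K' t => T K \ Bad K K' t, δ, W, hvol, hδ, hW, hW1, hZA, hZB, hpos,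
    hybridSandwich_of_offsetGoodClauses hA hB hbad hWA hWB hgood⟩

/-- … and NODE U0 (`Missing.HasContinuumLimit S`) by `NE7PairwiseCauchy.hasContinuumLimit_of_pairMatching`.
[folklore] -/
theorem hasContinuumLimit_of_offsetGoodClauses [RegularGaugeGroup G] {ι : Type*} [DecidableEq ι]
    (S : TorusScheme G O) (hβ : ∀ K, 0 ≤ S.β K) (hm : ∀ K o, Measurable (S.obs K o))
    (h1 : ∀ K o U, |S.obs K o U| ≤ 1) {l₀ : ℝ} (hl₀ : 0 < l₀)
    (h : ∀ os : List O, ∃ (vol : ℝ) (T : ℕ → Finset ι) (A : ℕ → ℝ → ι → ℝ) (B : ℕ → ℕ → ℝ → ι → ℝ)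
      (Bad : ℕ → ℕ → ℝ → Finset ι) (δ W : ℕ → ℝ), 0 < vol ∧ Tendsto δ atTop (𝓝 0) ∧ Tendsto W atTop (𝓝 0) ∧
      (∀ K, W K < 1) ∧
      (∀ (K : ℕ) (t : ℝ), |t| ≤ l₀ → T4GenFunBounds.schemeZ S os K t = ∑ τ ∈ T K, A K t τ) ∧
      (∀ (K K' : ℕ) (t : ℝ), K ≤ K' → |t| ≤ l₀ → T4GenFunBounds.schemeZ S os K' t = ∑ τ ∈ T K, B K K' t τ) ∧
      (∀ (K : ℕ) (t : ℝ), |t| ≤ l₀ → 0 < ∑ τ ∈ T K, A K t τ) ∧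
      (∀ K t, |t| ≤ l₀ → ∀ τ ∈ T K, 0 ≤ A K t τ) ∧
      (∀ K K' t, K ≤ K' → |t| ≤ l₀ → ∀ τ ∈ T K, 0 ≤ B K K' t τ) ∧
      (∀ K K' t, K ≤ K' → |t| ≤ l₀ → Bad K K' t ⊆ T K) ∧
      (∀ K K' t, K ≤ K' → |t| ≤ l₀ → ∑ τ ∈ Bad K K' t, A K t τ ≤ W K * ∑ τ ∈ T K, A K t τ) ∧
      (∀ K K' t, K ≤ K' → |t| ≤ l₀ → ∑ τ ∈ Bad K K' t, B K K' t τ ≤ W K * ∑ τ ∈ T K, B K K' t τ) ∧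
      (∀ n : ℕ, GoodClause l₀ vol T A (fun K => B K (K + n)) (fun K => Bad K (K + n)) δ)) :
    Missing.HasContinuumLimit S := by
  refine hasContinuumLimit_of_pairMatching S hβ hm h1 hl₀ fun os => ?_
  obtain ⟨vol, T, A, B, Bad, δ, W, hvol, hδ, hW, hW1, hZA, hZB, hpos, hA, hB, hbad, hWA, hWB, hgood⟩ := h os
  exact ⟨vol, hybridDelta vol δ W, tendsto_hybridDelta_zero vol hδ hW,
    pairMatching_of_offsetGoodClauses hvol hZA hZB hpos hW1 hA hB hbad hWA hWB hgood⟩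

end Exit

/-! ## §3 Road P1's currency is more than the socket asks -/

/-- BY-NAME REMARK: P1's END delivers `Summable δ` with `0 ≤ δ`; this socket consumes only `δ → 0`. [folklore] -/
theorem tendsto_zero_of_goodClause_summable {δ : ℕ → ℝ} (hδ : Summable δ) : Tendsto δ atTop (𝓝 0) :=
  hδ.tendsto_atTop_zero

/-! ## §4 (v1.1) Node U5 in the ℓ¹ currency passes through the pair-matching socket: «ℓ¹ ⟹ null» at the exit -/

/-- **CONSECUTIVE MATCHING WITH SUMMABLE REMAINDERS ⟹ PAIR MATCHING WITH A NULL TAIL REMAINDER.**  Node U5 as typed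
(`T4CauchySum.MatchingModConstants vol l₀ δ Z`: run `K+1` matches run `K` modulo a constant with remainder `vol·δ K`
on `|t| ≤ l₀`, `0 ≤ l₀`) with road P1's ∕ route ℓ¹'s currency `Summable δ` gives the hypothesis of (K1)
`NE7PairwiseCauchy.cauchySeq_genFun_of_pairMatching`: for all `K ≤ K′` the runs match modulo the constant
`Σ_{i∈[K,K′)} c_i` with remainder `vol·Σ'_i δ (i + K)` — the ℓ¹ TAIL, independent of `K′` (telescoping over the
runs; `0 ≤ vol·δ i` is read off the matching itself at `t = 0`). [folklore] -/
theorem pairMatching_of_matchingModConstants {vol l₀ : ℝ} {δ : ℕ → ℝ} {Z : ℕ → ℝ → ℝ}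
    (h : T4CauchySum.MatchingModConstants vol l₀ δ Z) (hl₀ : 0 ≤ l₀) (hδ : Summable δ) :
    ∀ K K' : ℕ, K ≤ K' → ∃ c : ℝ, ∀ t : ℝ, |t| ≤ l₀ →
      |Real.log (Z K' t) - Real.log (Z K t) - c| ≤ vol * ∑' i, δ (i + K) := by
  -- nonnegativity of the consecutive remainders, read at `t = 0`
  have hnn : ∀ i, 0 ≤ vol * δ i := fun i => by
    obtain ⟨c, hc⟩ := h i
    exact (abs_nonneg _).trans (hc 0 (by simpa using hl₀))
  have hsum : ∀ K, Summable (fun i => vol * δ (i + K)) := fun K =>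
    ((summable_nat_add_iff (f := δ) K).mpr hδ).mul_left vol
  -- telescoping over the runs `K, K+1, …, K+n`
  have htel : ∀ n K : ℕ, ∃ c : ℝ, ∀ t : ℝ, |t| ≤ l₀ →
      |Real.log (Z (K + n) t) - Real.log (Z K t) - c| ≤ ∑ i ∈ range n, vol * δ (i + K) := by
    intro n
    induction n with
    | zero => exact fun K => ⟨0, fun t _ => by simp⟩
    | succ n ih =>
      intro K
      obtain ⟨c, hc⟩ := ih K
      obtain ⟨c', hc'⟩ := h (K + n)
      refine ⟨c + c', fun t ht => ?_⟩
      rw [sum_range_succ]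
      have e : Real.log (Z (K + (n + 1)) t) - Real.log (Z K t) - (c + c')
          = (Real.log (Z (K + n + 1) t) - Real.log (Z (K + n) t) - c')
            + (Real.log (Z (K + n) t) - Real.log (Z K t) - c) := by
        rw [show K + (n + 1) = K + n + 1 from rfl]; ring
      rw [e]
      calc |(Real.log (Z (K + n + 1) t) - Real.log (Z (K + n) t) - c')
              + (Real.log (Z (K + n) t) - Real.log (Z K t) - c)|
          ≤ |Real.log (Z (K + n + 1) t) - Real.log (Z (K + n) t) - c'|
              + |Real.log (Z (K + n) t) - Real.log (Z K t) - c| := abs_add_le _ _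
        _ ≤ vol * δ (K + n) + ∑ i ∈ range n, vol * δ (i + K) := add_le_add (hc' t ht) (hc t ht)
        _ = ∑ i ∈ range n, vol * δ (i + K) + vol * δ (n + K) := by rw [add_comm K n]; ring
  intro K K' hKK'
  obtain ⟨c, hc⟩ := htel (K' - K) K
  refine ⟨c, fun t ht => ?_⟩
  have h1 := hc t ht
  rw [show K + (K' - K) = K' by omega] at h1
  refine h1.trans ?_
  rw [← tsum_mul_left]
  exact (hsum K).sum_le_tsum (range (K' - K)) fun i _ => hnn _

/-- The ℓ¹ tail remainder is null: `Σ'_i δ (i + K) → 0` (for ANY `δ`; `tendsto_sum_nat_add`). [folklore] -/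
theorem tendsto_l1TailRemainder (δ : ℕ → ℝ) : Tendsto (fun K => ∑' i, δ (i + K)) atTop (𝓝 0) :=
  tendsto_sum_nat_add δ

/-- **NODE U6 THROUGH THE PAIRWISE SOCKET, FROM NODE U5 IN ℓ¹ CURRENCY** — the by-name check that route
«PAIR-CAUCHY»'s (K1) exit reproduces road P1's ∕ route ℓ¹'s exit `T4CauchySum.cauchySeq_genFun` under the SAME
inputs (`MatchingModConstants` + `0 ≤ l₀` + `Summable δ`): consecutive-summable ⟹ pairwise-null
(`pairMatching_of_matchingModConstants`) ⟹ Cauchy (`NE7PairwiseCauchy.cauchySeq_genFun_of_pairMatching`).  With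
`NE7PairwiseCauchy.not_cauchySeq_of_harmonic_steps` (consecutive-NULL ⇏ Cauchy) this is the exit-level statement
of «ℓ¹ ⟹ null, and 1-bis literally». [folklore] -/
theorem cauchySeq_genFun_of_matchingModConstants_pairwise {vol l₀ : ℝ} {δ : ℕ → ℝ} {Z : ℕ → ℝ → ℝ}
    (h : T4CauchySum.MatchingModConstants vol l₀ δ Z) (hl₀ : 0 ≤ l₀) (hδ : Summable δ) {t : ℝ}
    (ht : |t| ≤ l₀) : CauchySeq fun K => T4CauchySum.genFun Z K t :=
  NE7PairwiseCauchy.cauchySeq_genFun_of_pairMatching hl₀ (pairMatching_of_matchingModConstants h hl₀ hδ)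
    (tendsto_l1TailRemainder δ) ht

end Summit.QuantumFields.BalabanUV.T4Continuum.NE7PairwiseOffsetEnd

end
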